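import Mathlib
import Literature.Probability.RandomMatrix.TwoQubitLambdaMaxSchurSection
import HarnessLib

/-!
# The volume of the Schur section as a spectral function

Support file for the proof of `ZhangJiangXie2025_qubit_blochFibre_lambdaMax_ratio`
(ZJX = Zhang–Jiang–Xie 2025, Prop. 6.10).

For a Hermitian `3 × 3` corner `A` and a real corner entry `c`, the `ℂ³`-volume of the two-sided
Schur section `schurSection A c = {v : 0 ≼ [[A, v], [v*, c]] ≼ ½}` depends on `A` only through its
spectrum: it equals `J(e; c) := π³ · vol₃ (cutSimplex e c)` if all eigenvalues `eᵢ ∈ (0, ½)` and `0`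
otherwise (`volume_schurSection_hermitian`).  Ingredients: unitary covariance of the section
(`volume_schurSection_conj`), the diagonal case of the companion file (`volume_schurSection`), and the
degenerate diagonal cases (an eigenvalue `≤ 0` or `≥ ½` forces the section into a coordinate
hyperplane).  We also record permutation invariance of `J` and the invariance of the eigenvalue
vector under unitary conjugation. [folklore]
-/

open _root_.MeasureTheory Set Real
open scoped ENNReal ComplexOrder Matrix ComplexConjugate
open Complex Matrix

noncomputable section

namespace Literature.Probability.RandomMatrix

namespace ZhangJiangXie2025

/-! ## Unitary covariance of the Schur section -/

/-- `½·1 − U A Uᴴ = U (½·1 − A) Uᴴ` for unitary `U`. [folklore] -/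
theorem half_sub_unitary_conj {U : Matrix (Fin 3) (Fin 3) ℂ} (hU : U ∈ Matrix.unitaryGroup (Fin 3) ℂ)
    (A : Matrix (Fin 3) (Fin 3) ℂ) :
    (2 : ℂ)⁻¹ • (1 : Matrix (Fin 3) (Fin 3) ℂ) - U * A * Uᴴ = U * ((2 : ℂ)⁻¹ • 1 - A) * Uᴴ := by
  have h2 : U * Uᴴ = 1 := Matrix.mem_unitaryGroup_iff.mp hU
  rw [Matrix.mul_sub, Matrix.sub_mul, Matrix.mul_smul, Matrix.mul_one, Matrix.smul_mul, h2]

/-- **Covariance**: `schurSection (U A Uᴴ) c = (Uᴴ ·)⁻¹ (schurSection A c)`. [folklore] -/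
theorem schurSection_conj {U : Matrix (Fin 3) (Fin 3) ℂ} (hU : U ∈ Matrix.unitaryGroup (Fin 3) ℂ)
    (A : Matrix (Fin 3) (Fin 3) ℂ) (c : ℝ) :
    schurSection (U * A * Uᴴ) c = (fun v : Fin 3 → ℂ => Uᴴ *ᵥ v) ⁻¹' schurSection A c := by
  have h2 : U * Uᴴ = 1 := Matrix.mem_unitaryGroup_iff.mp hU
  ext v
  obtain ⟨u, rfl⟩ : ∃ u, v = U *ᵥ u := ⟨Uᴴ *ᵥ v, by rw [mulVec_mulVec, h2, one_mulVec]⟩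
  have h1 : Uᴴ * U = 1 := Matrix.mem_unitaryGroup_iff'.mp hU
  simp only [schurSection, mem_setOf_eq, mem_preimage, mulVec_mulVec, h1, one_mulVec]
  refine and_congr (posSemidef_blk_conj_iff hU A u c) ?_
  rw [half_sub_blk, half_sub_blk, half_sub_unitary_conj hU, ← Matrix.mulVec_neg]
  exact posSemidef_blk_conj_iff hU _ _ _

/-- **Covariance of the volume**: `vol (schurSection (U A Uᴴ) c) = vol (schurSection A c)`.
[folklore] -/
theorem volume_schurSection_conj {U : Matrix (Fin 3) (Fin 3) ℂ}
    (hU : U ∈ Matrix.unitaryGroup (Fin 3) ℂ) (A : Matrix (Fin 3) (Fin 3) ℂ) (c : ℝ) :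
    volume (schurSection (U * A * Uᴴ) c) = volume (schurSection A c) := by
  rw [schurSection_conj hU]
  have hU' : Uᴴ ∈ Matrix.unitaryGroup (Fin 3) ℂ := by
    have := Unitary.star_mem hU; rwa [star_eq_conjTranspose] at this
  exact volume_preimage_mulVec_unitary hU' _

/-! ## Degenerate diagonal corners -/

/-- A PSD bordered diagonal block with a nonpositive diagonal entry `eᵢ ≤ 0` forces `vᵢ = 0`.
[folklore] -/
theorem blk_diag3_coord_eq_zero {e : Fin 3 → ℝ} {v : Fin 3 → ℂ} {c : ℂ}
    (h : (blk (diag3 e) v c).PosSemidef) {i : Fin 3} (hi : e i ≤ 0) : v i = 0 := by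
  set f : Fin 2 → Fin 3 ⊕ Fin 1 := ![Sum.inl i, Sum.inr 0] with hf
  have h2 := h.submatrix f
  have hM : (blk (diag3 e) v c).submatrix f f = !![((e i : ℝ) : ℂ), v i; conj (v i), c] := by
    ext a b
    fin_cases a <;> fin_cases b <;>
      simp [hf, blk, colv, diag3, Matrix.fromBlocks, Matrix.submatrix, Matrix.diagonal]
  rw [hM] at h2
  have hd : (0 : ℂ) ≤ ((e i : ℝ) : ℂ) := by simpa using h2.diag_nonneg (i := 0)
  have he0 : e i = 0 := le_antisymm hi (by simpa [Complex.zero_le_real] using hd)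
  have hdet := h2.det_nonneg
  rw [Matrix.det_fin_two_of, he0] at hdet
  simp only [Complex.ofReal_zero, zero_mul, zero_sub] at hdet
  have : normSq (v i) ≤ 0 := by
    rw [Complex.nonneg_iff] at hdet
    have h1 := hdet.1
    simp only [Complex.neg_re, Complex.mul_re, Complex.conj_re, Complex.conj_im] at h1
    rw [normSq_apply]; linarith
  exact Complex.normSq_eq_zero.mp (le_antisymm this (normSq_nonneg _))

/-- `½·1 − diag(e) = diag(½ − e)`. [folklore] -/
theorem half_sub_diag3 (e : Fin 3 → ℝ) :
    (2 : ℂ)⁻¹ • (1 : Matrix (Fin 3) (Fin 3) ℂ) - diag3 e = diag3 fun i => 1 / 2 - e i := by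
  have := half_sub_conj_diag3 (U := 1) (Submonoid.one_mem _) e
  simpa using this

/-- If some `eᵢ ≤ 0`, the section lies in the hyperplane `vᵢ = 0`. [folklore] -/
theorem schurSection_diag3_subset_of_nonpos {e : Fin 3 → ℝ} {i : Fin 3} (hi : e i ≤ 0) (c : ℝ) :
    schurSection (diag3 e) c ⊆ {v | v i = 0} := fun _ hv => blk_diag3_coord_eq_zero hv.1 hi

/-- If some `eᵢ ≥ ½`, the section lies in the hyperplane `vᵢ = 0`. [folklore] -/
theorem schurSection_diag3_subset_of_half_le {e : Fin 3 → ℝ} {i : Fin 3} (hi : 1 / 2 ≤ e i)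
    (c : ℝ) : schurSection (diag3 e) c ⊆ {v | v i = 0} := by
  intro v hv
  have h := hv.2
  rw [half_sub_blk, half_sub_diag3] at h
  have := blk_diag3_coord_eq_zero h (i := i) (by show 1 / 2 - e i ≤ 0; linarith)
  simpa using this

/-- A coordinate hyperplane in `ℂ³` is Lebesgue-null. [folklore] -/
theorem volume_coord_eq_zero (i : Fin 3) : volume {v : Fin 3 → ℂ | v i = 0} = 0 := by
  have : {v : Fin 3 → ℂ | v i = 0} = Function.eval i ⁻¹' {0} := rfl
  rw [this, volume_pi]
  exact Measure.pi_eval_preimage_null (μ := fun _ : Fin 3 => (volume : Measure ℂ))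
    (measure_singleton _)

/-! ## The spectral function `J` -/

/-- `J(e; c) = π³ vol₃ (cutSimplex e c)` if all `eᵢ ∈ (0, ½)`, else `0`. [folklore] -/
def Jd (e : Fin 3 → ℝ) (c : ℝ) : ℝ≥0∞ :=
  if (∀ i, 0 < e i) ∧ (∀ i, e i < 1 / 2) then ENNReal.ofReal π ^ 3 * volume (cutSimplex e c) else 0

/-- **Diagonal corner**: `vol (schurSection diag(e) c) = J(e; c)`. [folklore] -/
theorem volume_schurSection_diag3 (e : Fin 3 → ℝ) (c : ℝ) :
    volume (schurSection (diag3 e) c) = Jd e c := by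
  unfold Jd
  split_ifs with h
  · have := volume_schurSection (U := 1) (Submonoid.one_mem _) h.1 h.2 c
    simpa using this
  · rw [not_and_or, not_forall, not_forall] at h
    rcases h with ⟨i, hi⟩ | ⟨i, hi⟩
    · exact measure_mono_null (schurSection_diag3_subset_of_nonpos (not_lt.mp hi) c)
        (volume_coord_eq_zero i)
    · exact measure_mono_null (schurSection_diag3_subset_of_half_le (not_lt.mp hi) c)
        (volume_coord_eq_zero i)

/-- **Hermitian corner**: `vol (schurSection A c) = J(eig A; c)`. [folklore] -/
theorem volume_schurSection_hermitian {A : Matrix (Fin 3) (Fin 3) ℂ} (hA : A.IsHermitian) (c : ℝ) :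
    volume (schurSection A c) = Jd hA.eigenvalues c := by
  set U : Matrix (Fin 3) (Fin 3) ℂ := (hA.eigenvectorUnitary : Matrix (Fin 3) (Fin 3) ℂ) with hU
  have hUmem : U ∈ Matrix.unitaryGroup (Fin 3) ℂ := hA.eigenvectorUnitary.2
  have hspec : A = U * diag3 hA.eigenvalues * Uᴴ := by
    have h := hA.spectral_theorem
    rw [Unitary.conjStarAlgAut_apply] at h
    rw [← star_eq_conjTranspose]
    exact h
  have hset : schurSection A c = schurSection (U * diag3 hA.eigenvalues * Uᴴ) c := by
    rw [← hspec]
  rw [hset, volume_schurSection_conj hUmem, volume_schurSection_diag3]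

/-! ## Permutation invariance of `J` -/

/-- Relabelling the coordinates identifies `cutSimplex (e ∘ σ) c` with `cutSimplex e c`. [folklore] -/
theorem cutSimplex_comp_equiv (e : Fin 3 → ℝ) (c : ℝ) (σ : Fin 3 ≃ Fin 3) :
    cutSimplex (e ∘ σ) c =
      (MeasurableEquiv.piCongrLeft (fun _ : Fin 3 => ℝ) σ) ⁻¹' cutSimplex e c := by
  ext s
  simp only [cutSimplex, mem_setOf_eq, mem_preimage, MeasurableEquiv.coe_piCongrLeft,
    Function.comp_apply]
  have hval : ∀ a, (Equiv.piCongrLeft (fun _ : Fin 3 => ℝ) σ) s (σ a) = s a := fun a =>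
    Equiv.piCongrLeft_apply_apply (P := fun _ : Fin 3 => ℝ) (e := σ) s a
  refine and_congr ?_ (and_congr ?_ ?_)
  · constructor
    · intro h j
      obtain ⟨a, rfl⟩ := σ.surjective j
      rw [hval]; exact h a
    · intro h a
      have := h (σ a); rwa [hval] at this
  · rw [← Equiv.sum_comp σ (fun j => (Equiv.piCongrLeft (fun _ : Fin 3 => ℝ) σ) s j / e j)]
    simp only [hval]
  · rw [← Equiv.sum_comp σ (fun j => (Equiv.piCongrLeft (fun _ : Fin 3 => ℝ) σ) s j / (1 / 2 - e j))]
    simp only [hval]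

/-- `vol (cutSimplex (e ∘ σ) c) = vol (cutSimplex e c)`. [folklore] -/
theorem volume_cutSimplex_comp_equiv (e : Fin 3 → ℝ) (c : ℝ) (σ : Fin 3 ≃ Fin 3) :
    volume (cutSimplex (e ∘ σ) c) = volume (cutSimplex e c) := by
  rw [cutSimplex_comp_equiv]
  exact (volume_measurePreserving_piCongrLeft (fun _ : Fin 3 => ℝ) σ).measure_preimage
    (measurableSet_cutSimplex e c).nullMeasurableSet

/-- `J(e ∘ σ; c) = J(e; c)`. [folklore] -/
theorem Jd_comp_equiv (e : Fin 3 → ℝ) (c : ℝ) (σ : Fin 3 ≃ Fin 3) : Jd (e ∘ σ) c = Jd e c := by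
  unfold Jd
  have h1 : (∀ i, 0 < (e ∘ σ) i) ↔ ∀ i, 0 < e i :=
    ⟨fun h i => by simpa using h (σ.symm i), fun h i => h _⟩
  have h2 : (∀ i, (e ∘ σ) i < 1 / 2) ↔ ∀ i, e i < 1 / 2 :=
    ⟨fun h i => by simpa using h (σ.symm i), fun h i => h _⟩
  simp only [h1, h2, volume_cutSimplex_comp_equiv]

/-! ## Sorted eigenvalues -/

/-- The antitone eigenvalue vector of a Hermitian `3 × 3` matrix, indexed by `Fin 3`. [folklore] -/
def esort {A : Matrix (Fin 3) (Fin 3) ℂ} (hA : A.IsHermitian) : Fin 3 → ℝ :=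
  fun i => hA.eigenvalues₀ (i.cast (Fintype.card_fin 3).symm)

/-- The relabelling between `eigenvalues` and `esort`. [folklore] -/
def eperm : Fin 3 ≃ Fin 3 :=
  (Fintype.equivOfCardEq (Fintype.card_fin (Fintype.card (Fin 3)))).symm.trans
    (finCongr (Fintype.card_fin 3))

/-- `eigenvalues = esort ∘ eperm`. [folklore] -/
theorem eigenvalues_eq_esort_comp {A : Matrix (Fin 3) (Fin 3) ℂ} (hA : A.IsHermitian) :
    hA.eigenvalues = esort hA ∘ eperm := by
  funext i
  rfl

/-- `esort` is antitone (sorted decreasingly). [folklore] -/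
theorem esort_antitone {A : Matrix (Fin 3) (Fin 3) ℂ} (hA : A.IsHermitian) : Antitone (esort hA) :=
  fun a b hij => hA.eigenvalues₀_antitone
    (show a.cast (Fintype.card_fin 3).symm ≤ b.cast (Fintype.card_fin 3).symm from hij)

/-- **Hermitian corner, sorted form**: `vol (schurSection A c) = J(esort A; c)`. [folklore] -/
theorem volume_schurSection_eq_Jd_esort {A : Matrix (Fin 3) (Fin 3) ℂ} (hA : A.IsHermitian) (c : ℝ) :
    volume (schurSection A c) = Jd (esort hA) c := by
  rw [volume_schurSection_hermitian hA, eigenvalues_eq_esort_comp, Jd_comp_equiv]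

/-- `esort` is a similarity invariant: equal characteristic polynomials give equal `esort`.
[folklore] -/
theorem esort_eq_of_charpoly_eq {A B : Matrix (Fin 3) (Fin 3) ℂ} (hA : A.IsHermitian)
    (hB : B.IsHermitian) (h : A.charpoly = B.charpoly) : esort hA = esort hB := by
  have h0 : hA.eigenvalues₀ = hB.eigenvalues₀ := by
    rw [← List.ofFn_inj, ← hA.sort_roots_charpoly_eq_eigenvalues₀,
      ← hB.sort_roots_charpoly_eq_eigenvalues₀, h]
  funext i
  simp only [esort, h0]

/-- Unitary conjugation preserves the characteristic polynomial. [folklore] -/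
theorem charpoly_unitary_conj {U : Matrix (Fin 3) (Fin 3) ℂ} (hU : U ∈ Matrix.unitaryGroup (Fin 3) ℂ)
    (A : Matrix (Fin 3) (Fin 3) ℂ) : (U * A * Uᴴ).charpoly = A.charpoly := by
  have h1 : Uᴴ * U = 1 := Matrix.mem_unitaryGroup_iff'.mp hU
  have h2 : U * Uᴴ = 1 := Matrix.mem_unitaryGroup_iff.mp hU
  set M : (Matrix (Fin 3) (Fin 3) ℂ)ˣ := ⟨U, Uᴴ, h2, h1⟩ with hM
  have : (M.val * A * M.val⁻¹).charpoly = A.charpoly := Matrix.charpoly_units_conj M A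
  have hinv : (M.val⁻¹ : Matrix (Fin 3) (Fin 3) ℂ) = Uᴴ := Matrix.inv_eq_left_inv h1
  rwa [hinv] at this

/-- `esort (U A Uᴴ) = esort A` for unitary `U`. [folklore] -/
theorem esort_unitary_conj {U : Matrix (Fin 3) (Fin 3) ℂ} (hU : U ∈ Matrix.unitaryGroup (Fin 3) ℂ)
    {A : Matrix (Fin 3) (Fin 3) ℂ} (hA : A.IsHermitian) (hUA : (U * A * Uᴴ).IsHermitian) :
    esort hUA = esort hA :=
  esort_eq_of_charpoly_eq hUA hA (charpoly_unitary_conj hU A)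

end ZhangJiangXie2025

end Literature.Probability.RandomMatrix

end
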